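import Summits.KontsevichZagierPeriods.KontsevichZagierPeriods.Theorems.ValuedFieldSpecialisationCTConstructionDilateMap
import Summits.KontsevichZagierPeriods.KontsevichZagierPeriods.Theorems.ValuedFieldSpecialisationCTConstructionBlowupExists

/-!
# Route ValuedFieldSpecialisation — crux `CTConstruction`: the blow-up preserves fibred relations

Helper toward crux stmt-KontsevichZagierPeriods-3495 (`CTConstruction`), line `registered`,
reshape r4 (blow-up elimination of the log block), stub `stub_blowupMap_mem_fibredRelations`.
The fibred relations `KZ.fibredRelations = AddSubgroup.closure KZ.fibredGenerators`
(`Literature/NumberTheory/Transcendental/KZFibredRelations.lean`) are generated by the moves of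
the Kontsevich–Zagier calculus applied uniformly in the parameter `s = z 0`. The weight-slab
blow-up of a family `r : IntegralRep (k + 1)` (companion file `…CTConstructionBlowupExists.lean`)
is any `r'` with `r'.domain = {z | 0 < z 1 < z 0 < 1, tail z ∈ r.domain}` and
`r'.integrand z = (z 1 / z 0 ^ 2) · r.integrand (tail z)`.

`stub_blowupMap_mem_fibredRelations`: blowing up every family of a fibred chain gives a fibred
chain — generatorwise (template `KZ.slabMap_mem_fibredRelations`): domain/integrand additivity
(the cut and the weight are common to all three families; the null overlap has null preimage
under the tail projection), fibred changes of variables (the block substitution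
`(σ, y) ↦ (σ, Φ y)`, `det = det Φ'` by `LinearMap.det_conj`/`LinearMap.det_prodMap`; it maps
blow-up domain onto blow-up domain BECAUSE `Φ` preserves `y 0 = t`), fibred Newton–Leibniz
moves (the cut and the weight only read the base coordinates `σ`, `t`; new primitive
`(t / σ²) F (tail z)`); then `AddSubgroup.closure_le`.

Sources: M. Kontsevich, D. Zagier, *Periods* (2001), §1.2 (rules (1)–(3)); J. Bochnak, M. Coste,
M.-F. Roy, *Real Algebraic Geometry* (1998), §2.2 (Prop. 2.2.6, semialgebraic maps). No new
definitions; nothing here about dominated families, the sheared blow-up or elementary products.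
-/

noncomputable section

namespace Summit.KontsevichZagierPeriods.ValuedFieldSpecialisation

open MeasureTheory Set Filter MvPolynomial
open scoped Topology
open Literature.NumberTheory.Transcendental Literature.NumberTheory.Transcendental.KZ
open Literature.ModelTheory.ExponentialFields (IsSemialgebraic)

/-! ## The blow-up commutes with the base/fibre splitting of a band -/

/-- The fibre coordinate of a band is not seen by the blow-up weight: `(Fin.snoc x t) 1 = x 1`
(`x : ℝᵐ⁺²`). [folklore] -/
theorem blowup_snoc_apply_one {m : ℕ} (x : Fin (m + 1 + 1) → ℝ) (t : ℝ) :
    (Fin.snoc x t : Fin (m + 1 + 1 + 1) → ℝ) 1 = x 1 := by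
  rw [← Fin.castSucc_one, Fin.snoc_castSucc]

/-- Tail and `Fin.snoc` commute: `tail (Fin.snoc x t) = Fin.snoc (tail x) t`, coordinatewise.
[folklore] -/
theorem blowup_snoc_apply_succ {m : ℕ} (x : Fin (m + 1) → ℝ) (t : ℝ) (i : Fin (m + 1)) :
    (Fin.snoc x t : Fin (m + 1 + 1) → ℝ) i.succ =
      (Fin.snoc (fun j : Fin m => x j.succ) t : Fin (m + 1) → ℝ) i := by
  refine Fin.lastCases ?_ (fun j => ?_) i
  · simp only [Fin.succ_last, Fin.snoc_last]
  · rw [Fin.succ_castSucc, Fin.snoc_castSucc, Fin.snoc_castSucc]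

/-! ## The blow-up preserves the four kinds of fibred generators -/

/-- **Blowing up a domain-additivity instance** (dimension `≥ 1`) gives a domain-additivity
instance: the blow-up domains are `C ∩ tail⁻¹(σ)` for the common cut `C = {0 < z 1 < z 0 < 1}`, so
`C ∩ tail⁻¹(σ₁ ∪ σ₂) = (C ∩ tail⁻¹ σ₁) ∪ (C ∩ tail⁻¹ σ₂)`, the overlap lies in the preimage under
the tail projection of the null set `σ₁ ∩ σ₂` (`volume_setOf_tail_mem_eq_zero`), and the weighted
integrands agree where the original ones do. [Kontsevich–Zagier 2001, §1.2 rule (1)] [folklore] -/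
theorem blowup_sub_mem_domainAddRel {k : ℕ} {r r₁ r₂ : IntegralRep (k + 1)}
    {s s₁ s₂ : IntegralRep (k + 1 + 1)}
    (hdom : r.domain = r₁.domain ∪ r₂.domain) (hnull : volume (r₁.domain ∩ r₂.domain) = 0)
    (h₁ : EqOn r.integrand r₁.integrand r₁.domain) (h₂ : EqOn r.integrand r₂.integrand r₂.domain)
    (hs : s.domain = {z | 0 < z 1 ∧ z 1 < z 0 ∧ z 0 < 1 ∧
      (fun i : Fin (k + 1) => z i.succ) ∈ r.domain})
    (hsi : s.integrand = fun z => z 1 / z 0 ^ 2 * r.integrand (fun i : Fin (k + 1) => z i.succ))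
    (hs₁ : s₁.domain = {z | 0 < z 1 ∧ z 1 < z 0 ∧ z 0 < 1 ∧
      (fun i : Fin (k + 1) => z i.succ) ∈ r₁.domain})
    (hsi₁ : s₁.integrand = fun z => z 1 / z 0 ^ 2 * r₁.integrand (fun i : Fin (k + 1) => z i.succ))
    (hs₂ : s₂.domain = {z | 0 < z 1 ∧ z 1 < z 0 ∧ z 0 < 1 ∧
      (fun i : Fin (k + 1) => z i.succ) ∈ r₂.domain})
    (hsi₂ : s₂.integrand = fun z =>
      z 1 / z 0 ^ 2 * r₂.integrand (fun i : Fin (k + 1) => z i.succ)) :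
    of s - of s₁ - of s₂ ∈ domainAddRel := by
  refine ⟨k + 1 + 1, s, s₁, s₂, ?_, ?_, ?_, ?_, rfl⟩
  · rw [hs, hs₁, hs₂, hdom]
    ext z
    simp only [mem_setOf_eq, mem_union]
    tauto
  · refine measure_mono_null (fun z hz => ?_) (volume_setOf_tail_mem_eq_zero hnull)
    rw [hs₁, hs₂] at hz
    exact ⟨hz.1.2.2.2, hz.2.2.2.2⟩
  · intro z hz
    rw [hs₁, mem_setOf_eq] at hz
    simp only [hsi, hsi₁]
    rw [h₁ hz.2.2.2]
  · intro z hz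
    rw [hs₂, mem_setOf_eq] at hz
    simp only [hsi, hsi₂]
    rw [h₂ hz.2.2.2]

/-- **Blowing up an integrand-additivity instance** (dimension `≥ 1`) gives an
integrand-additivity instance: same blow-up domain,
`(t / σ²)(f₁ + f₂) = (t / σ²) f₁ + (t / σ²) f₂`.
[Kontsevich–Zagier 2001, §1.2 rule (1)] [folklore] -/
theorem blowup_sub_mem_integrandAddRel {k : ℕ} {r r₁ r₂ : IntegralRep (k + 1)}
    {s s₁ s₂ : IntegralRep (k + 1 + 1)}
    (h₁ : r₁.domain = r.domain) (h₂ : r₂.domain = r.domain)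
    (hadd : EqOn r.integrand (r₁.integrand + r₂.integrand) r.domain)
    (hs : s.domain = {z | 0 < z 1 ∧ z 1 < z 0 ∧ z 0 < 1 ∧
      (fun i : Fin (k + 1) => z i.succ) ∈ r.domain})
    (hsi : s.integrand = fun z => z 1 / z 0 ^ 2 * r.integrand (fun i : Fin (k + 1) => z i.succ))
    (hs₁ : s₁.domain = {z | 0 < z 1 ∧ z 1 < z 0 ∧ z 0 < 1 ∧
      (fun i : Fin (k + 1) => z i.succ) ∈ r₁.domain})
    (hsi₁ : s₁.integrand = fun z => z 1 / z 0 ^ 2 * r₁.integrand (fun i : Fin (k + 1) => z i.succ))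
    (hs₂ : s₂.domain = {z | 0 < z 1 ∧ z 1 < z 0 ∧ z 0 < 1 ∧
      (fun i : Fin (k + 1) => z i.succ) ∈ r₂.domain})
    (hsi₂ : s₂.integrand = fun z =>
      z 1 / z 0 ^ 2 * r₂.integrand (fun i : Fin (k + 1) => z i.succ)) :
    of s - of s₁ - of s₂ ∈ integrandAddRel := by
  refine ⟨k + 1 + 1, s, s₁, s₂, by rw [hs₁, hs, h₁], by rw [hs₂, hs, h₂], ?_, rfl⟩
  intro z hz
  rw [hs, mem_setOf_eq] at hz
  simp only [hsi, hsi₁, hsi₂, Pi.add_apply]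
  rw [hadd hz.2.2.2, Pi.add_apply, mul_add]

/-- **Blowing up a fibred change of variables gives a fibred change of variables.** For the data
`Φ`, `Φ'` on `r.domain ⊆ ℝᵏ⁺¹` with `Φ x 0 = x 0`, the blow-ups `s`, `s'` of `r`, `r'` are related
by the block substitution `Ψ z = (z 0, Φ (tail z))` on `s.domain`: `ℚ`-semialgebraic
(coordinatewise, `IsSemialgebraicMapOn.of_forall`, the coordinates of `Φ ∘ tail` being cylinders
over those of `Φ`), with derivative `Ψ' z = E⁻¹ ∘L (id × Φ' (tail z)) ∘L E` through the linear
identification `E : ℝᵏ⁺² ≃ ℝ × ℝᵏ⁺¹`, `z ↦ (z 0, tail z)` (chain rule,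
`HasFDerivWithinAt.prodMap`), injective, `det Ψ' z = det Φ' (tail z)` (`LinearMap.det_conj`,
`LinearMap.det_prodMap`); it maps `s.domain` onto `s'.domain` because `Φ` preserves the coordinate
`t = (tail z) 0 = z 1` read by the cut, fixes `σ = z 0`, and the weight `t / σ²` is the same on
both sides of the Jacobian identity. [Kontsevich–Zagier 2001, §1.2 rule (2)] [folklore] -/
theorem blowup_sub_mem_fibredChangeOfVariablesRel {k : ℕ} {r r' : IntegralRep (k + 1)}
    {s s' : IntegralRep (k + 1 + 1)}
    {Φ : (Fin (k + 1) → ℝ) → (Fin (k + 1) → ℝ)}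
    {Φ' : (Fin (k + 1) → ℝ) → (Fin (k + 1) → ℝ) →L[ℝ] (Fin (k + 1) → ℝ)}
    (hΦ : IsSemialgebraicMapOn ℚ r.domain Φ)
    (hΦ' : ∀ x ∈ r.domain, HasFDerivWithinAt Φ (Φ' x) r.domain x) (hinj : InjOn Φ r.domain)
    (hdom : r'.domain = Φ '' r.domain)
    (hf : ∀ x ∈ r.domain, r.integrand x = r'.integrand (Φ x) * |(Φ' x).det|)
    (h0 : ∀ x ∈ r.domain, Φ x 0 = x 0)
    (hs : s.domain = {z | 0 < z 1 ∧ z 1 < z 0 ∧ z 0 < 1 ∧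
      (fun i : Fin (k + 1) => z i.succ) ∈ r.domain})
    (hsi : s.integrand = fun z => z 1 / z 0 ^ 2 * r.integrand (fun i : Fin (k + 1) => z i.succ))
    (hs' : s'.domain = {z | 0 < z 1 ∧ z 1 < z 0 ∧ z 0 < 1 ∧
      (fun i : Fin (k + 1) => z i.succ) ∈ r'.domain})
    (hsi' : s'.integrand = fun z =>
      z 1 / z 0 ^ 2 * r'.integrand (fun i : Fin (k + 1) => z i.succ)) :
    of s - of s' ∈ fibredChangeOfVariablesRel := by
  -- the linear identification `ℝᵏ⁺² ≃ ℝ × ℝᵏ⁺¹`, `z ↦ (z 0, tail z)`, inverse `vecCons`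
  let e : (Fin (k + 1 + 1) → ℝ) ≃ₗ[ℝ] ℝ × (Fin (k + 1) → ℝ) :=
    { toFun := fun z => (z 0, fun i => z i.succ)
      invFun := fun p => Matrix.vecCons p.1 p.2
      map_add' := fun x y => rfl
      map_smul' := fun c x => rfl
      left_inv := fun z => Matrix.cons_head_tail z
      right_inv := fun p => by
        obtain ⟨a, u⟩ := p
        simp only [Matrix.cons_val_zero, Matrix.cons_val_succ] }
  let eL : (Fin (k + 1 + 1) → ℝ) ≃L[ℝ] ℝ × (Fin (k + 1) → ℝ) := e.toContinuousLinearEquiv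
  have heL : ∀ z, eL z = (z 0, fun i => z i.succ) := fun z => rfl
  -- the block substitution and its derivative
  let Ψ : (Fin (k + 1 + 1) → ℝ) → (Fin (k + 1 + 1) → ℝ) := eL.symm ∘ Prod.map id Φ ∘ eL
  let Ψ' : (Fin (k + 1 + 1) → ℝ) → (Fin (k + 1 + 1) → ℝ) →L[ℝ] (Fin (k + 1 + 1) → ℝ) := fun z =>
    (eL.symm : _ →L[ℝ] _).comp ((((ContinuousLinearMap.id ℝ ℝ).prodMap
      (Φ' (fun i => z i.succ)))).comp (eL : _ →L[ℝ] _))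
  have hΨ : ∀ z, Ψ z = Matrix.vecCons (z 0) (Φ fun i => z i.succ) := fun z => rfl
  have hΨ0 : ∀ z, Ψ z 0 = z 0 := fun z => by rw [hΨ, Matrix.cons_val_zero]
  have hΨs : ∀ z (i : Fin (k + 1)), Ψ z i.succ = Φ (fun i => z i.succ) i := fun z i => by
    rw [hΨ, Matrix.cons_val_succ]
  have hdet : ∀ z, (Ψ' z).det = (Φ' (fun i => z i.succ)).det := by
    intro z
    have hcoe : ((Ψ' z : (Fin (k + 1 + 1) → ℝ) →L[ℝ] (Fin (k + 1 + 1) → ℝ)) :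
        (Fin (k + 1 + 1) → ℝ) →ₗ[ℝ] (Fin (k + 1 + 1) → ℝ)) =
      (e.symm : ℝ × (Fin (k + 1) → ℝ) →ₗ[ℝ] (Fin (k + 1 + 1) → ℝ)) ∘ₗ
        (((LinearMap.id : ℝ →ₗ[ℝ] ℝ).prodMap
          ((Φ' (fun i => z i.succ) : (Fin (k + 1) → ℝ) →L[ℝ] (Fin (k + 1) → ℝ)) :
            (Fin (k + 1) → ℝ) →ₗ[ℝ] (Fin (k + 1) → ℝ))) ∘ₗ
        (e.symm.symm : (Fin (k + 1 + 1) → ℝ) →ₗ[ℝ] ℝ × (Fin (k + 1) → ℝ))) :=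
      LinearMap.ext fun v => rfl
    change LinearMap.det _ = LinearMap.det _
    rw [hcoe, LinearMap.det_conj, LinearMap.det_prodMap, LinearMap.det_id, one_mul]
  have hsub : ∀ z ∈ s.domain, (fun i : Fin (k + 1) => z i.succ) ∈ r.domain := fun z hz => by
    rw [hs] at hz
    exact hz.2.2.2
  -- `Φ (tail z) 0 = z 1`
  have h01 : ∀ z ∈ s.domain, Φ (fun i : Fin (k + 1) => z i.succ) 0 = z 1 := fun z hz => by
    rw [h0 _ (hsub z hz)]
    exact congrArg z Fin.succ_zero_eq_one
  refine of_sub_of_mem_fibredChangeOfVariablesRel (Φ := Ψ) (Φ' := Ψ') ?_ ?_ ?_ ?_ ?_ ?_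
  · -- semialgebraic, coordinatewise
    refine IsSemialgebraicMapOn.of_forall s.isSemialgebraic_domain fun j => ?_
    refine Fin.cases ?_ (fun i => ?_) j
    · simp only [hΨ0]
      simpa using isSemialgebraicFunOn_aeval s.isSemialgebraic_domain
        (X (0 : Fin (k + 1 + 1)) : MvPolynomial (Fin (k + 1 + 1)) ℚ)
    · simp only [hΨs]
      exact (((isSemialgebraicMapOn_iff_forall_holds r.isSemialgebraic_domain).mp hΦ
        i).comp_tail).mono hsub s.isSemialgebraic_domain
  · -- derivative within `s.domain ⊆ E⁻¹(ℝ × r.domain)`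
    intro z hz
    have hx := hsub z hz
    have hg : HasFDerivWithinAt (Prod.map id Φ)
        ((ContinuousLinearMap.id ℝ ℝ).prodMap (Φ' (fun i => z i.succ)))
        ((univ : Set ℝ) ×ˢ r.domain) (eL z) := by
      refine HasFDerivWithinAt.prodMap (eL z) (hasFDerivWithinAt_id _ _) ((hΦ' _ hx).mono ?_)
      rintro _ ⟨q, hq, rfl⟩
      exact hq.2
    have h2 := (eL.symm.comp_hasFDerivWithinAt_iff).mpr hg
    have h3 := (eL.comp_right_hasFDerivWithinAt_iff (f := eL.symm ∘ Prod.map id Φ)).mpr h2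
    exact h3.mono fun w hw => ⟨mem_univ _, hsub w hw⟩
  · -- injective
    intro z₁ hz₁ z₂ hz₂ h
    have h0' : z₁ 0 = z₂ 0 := by rw [← hΨ0 z₁, ← hΨ0 z₂, h]
    have ht : (fun i : Fin (k + 1) => z₁ i.succ) = fun i => z₂ i.succ :=
      hinj (hsub z₁ hz₁) (hsub z₂ hz₂) (funext fun i => by rw [← hΨs z₁, ← hΨs z₂, h])
    rw [← Matrix.cons_head_tail z₁, ← Matrix.cons_head_tail z₂]
    exact congrArg₂ Matrix.vecCons h0' ht
  · -- image
    ext y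
    rw [hs', mem_setOf_eq, hdom]
    constructor
    · rintro ⟨hy1, hy10, hy0, x, hx, hxy⟩
      have hx1 : x 0 = y 1 := by
        rw [← h0 x hx, hxy]
        exact congrArg y Fin.succ_zero_eq_one
      refine ⟨Matrix.vecCons (y 0) x, ?_, ?_⟩
      · rw [hs, mem_setOf_eq]
        simp only [Matrix.cons_val_zero, Matrix.cons_val_one, Matrix.cons_val_succ, hx1]
        exact ⟨hy1, hy10, hy0, hx⟩
      · rw [hΨ]
        simp only [Matrix.cons_val_zero, Matrix.cons_val_succ, hxy]
        exact Matrix.cons_head_tail y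
    · rintro ⟨z, hz, rfl⟩
      have hz' := hz
      rw [hs, mem_setOf_eq] at hz'
      refine ⟨?_, ?_, ?_, _, hsub z hz, funext fun i => (hΨs z i).symm⟩
      · rw [← Fin.succ_zero_eq_one, hΨs, h01 z hz]
        exact hz'.1
      · rw [← Fin.succ_zero_eq_one, hΨs, h01 z hz, hΨ0]
        exact hz'.2.1
      · rw [hΨ0]
        exact hz'.2.2.1
  · -- the integrand identity
    intro z hz
    have hx := hsub z hz
    have hΨ1 : Ψ z 1 = z 1 := by
      have h := hΨs z 0
      rw [Fin.succ_zero_eq_one, h01 z hz] at h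
      exact h
    have hΨt : (fun i : Fin (k + 1) => Ψ z i.succ) = Φ (fun i => z i.succ) := funext (hΨs z)
    simp only [hsi, hsi']
    rw [hdet, hΨ0, hΨ1, hΨt, hf _ hx, mul_assoc]
  · exact fun z _ => hΨ0 z

/-- **Blowing up a Newton–Leibniz move over a base of dimension `≥ 1` gives such a move.** The
blow-up cut `{0 < z 1 < z 0 < 1}` and weight `z 1 / z 0 ^ 2` only read the coordinates `0`, `1`,
which are base coordinates of the blown-up band (`(Fin.init z) 0 = z 0`, `(Fin.init z) 1 = z 1`,
`Fin.init (tail z) = tail (Fin.init z)`, `tail (Fin.snoc x t) = Fin.snoc (tail x) t`), so the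
blow-up `s` of the band `r` is the band over the blow-up `s'` of the base `r'` with bounds
`α ∘ tail`, `β ∘ tail` and primitive `z ↦ (z 1 / z 0 ^ 2) F (tail z)` (semialgebraic by
`isSemialgebraicFunOn_blowupWeight_mul`; the weight is constant along each fibre, so fibrewise
continuity, derivative and the boundary identity are multiplied by it).
[Kontsevich–Zagier 2001, §1.2 rule (3)] [folklore] -/
theorem blowup_sub_mem_newtonLeibnizRel {k : ℕ} {r : IntegralRep (k + 1 + 1)}
    {s : IntegralRep (k + 1 + 1 + 1)} {r' : IntegralRep (k + 1)} {s' : IntegralRep (k + 1 + 1)}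
    {α β : (Fin (k + 1) → ℝ) → ℝ} {F : (Fin (k + 1 + 1) → ℝ) → ℝ}
    (hF : IsSemialgebraicFunOn ℚ r.domain F)
    (hα : IsSemialgebraicFunOn ℚ r'.domain α) (hβ : IsSemialgebraicFunOn ℚ r'.domain β)
    (hle : ∀ x ∈ r'.domain, α x ≤ β x)
    (hband : r.domain = {z | (Fin.init z : Fin (k + 1) → ℝ) ∈ r'.domain ∧
      α (Fin.init z) ≤ z (Fin.last (k + 1)) ∧ z (Fin.last (k + 1)) ≤ β (Fin.init z)})
    (hcont : ∀ x ∈ r'.domain, ContinuousOn (fun t : ℝ => F (Fin.snoc x t)) (Icc (α x) (β x)))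
    (hderiv : ∀ x ∈ r'.domain, ∀ t ∈ Ioo (α x) (β x),
      HasDerivAt (fun s : ℝ => F (Fin.snoc x s)) (r.integrand (Fin.snoc x t)) t)
    (hr' : ∀ x ∈ r'.domain, r'.integrand x = F (Fin.snoc x (β x)) - F (Fin.snoc x (α x)))
    (hs : s.domain = {z | 0 < z 1 ∧ z 1 < z 0 ∧ z 0 < 1 ∧
      (fun i : Fin (k + 1 + 1) => z i.succ) ∈ r.domain})
    (hsi : s.integrand = fun z =>
      z 1 / z 0 ^ 2 * r.integrand (fun i : Fin (k + 1 + 1) => z i.succ))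
    (hs' : s'.domain = {z | 0 < z 1 ∧ z 1 < z 0 ∧ z 0 < 1 ∧
      (fun i : Fin (k + 1) => z i.succ) ∈ r'.domain})
    (hsi' : s'.integrand = fun z =>
      z 1 / z 0 ^ 2 * r'.integrand (fun i : Fin (k + 1) => z i.succ)) :
    of s - of s' ∈ newtonLeibnizRel := by
  have hsub : ∀ z ∈ s.domain, (fun i : Fin (k + 1 + 1) => z i.succ) ∈ r.domain := fun z hz => by
    rw [hs] at hz
    exact hz.2.2.2
  have hsub' : ∀ x ∈ s'.domain, (fun i : Fin (k + 1) => x i.succ) ∈ r'.domain := fun x hx => by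
    rw [hs'] at hx
    exact hx.2.2.2
  have hpos : ∀ z ∈ s.domain, z 0 ≠ 0 := fun z hz => by
    rw [hs] at hz
    exact (hz.1.trans hz.2.1).ne'
  refine ⟨k + 1 + 1, s, s', fun x => α (fun i : Fin (k + 1) => x i.succ),
    fun x => β (fun i : Fin (k + 1) => x i.succ),
    fun z => z 1 / z 0 ^ 2 * F (fun i : Fin (k + 1 + 1) => z i.succ),
    isSemialgebraicFunOn_blowupWeight_mul s.isSemialgebraic_domain hpos hF hsub,
    hα.comp_tail.mono hsub' s'.isSemialgebraic_domain,
    hβ.comp_tail.mono hsub' s'.isSemialgebraic_domain,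
    fun x hx => hle _ (hsub' x hx), ?_, ?_, ?_, ?_, rfl⟩
  · -- the blown-up band is the band over the blown-up base
    rw [hs]
    ext z
    have e1 : Fin.init (fun i : Fin (k + 1 + 1) => z i.succ) =
        fun i : Fin (k + 1) => Fin.init z i.succ :=
      (Fin.tail_init_eq_init_tail z).symm
    have e2 : (Fin.init z : Fin (k + 1 + 1) → ℝ) 1 = z 1 := congrArg z Fin.castSucc_one
    have e3 : (Fin.init z : Fin (k + 1 + 1) → ℝ) 0 = z 0 := rfl
    simp only [mem_setOf_eq, hs', hband, e1, e2, e3, Fin.succ_last]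
    tauto
  · intro x hx
    simp only [Fin.snoc_apply_zero, blowup_snoc_apply_one, blowup_snoc_apply_succ]
    exact (hcont _ (hsub' x hx)).const_mul (x 1 / x 0 ^ 2)
  · intro x hx t ht
    simp only [hsi, Fin.snoc_apply_zero, blowup_snoc_apply_one, blowup_snoc_apply_succ]
    exact (hderiv _ (hsub' x hx) t ht).const_mul (x 1 / x 0 ^ 2)
  · intro x hx
    simp only [hsi', Fin.snoc_apply_zero, blowup_snoc_apply_one, blowup_snoc_apply_succ]
    rw [hr' _ (hsub' x hx), mul_sub]

/-! ## Assembly: the blow-up map preserves fibred relations -/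

/-- **Stub `stub_blowupMap_mem_fibredRelations` (the generatorwise blow-up map preserves fibred
relations).** For ANY map `T` on the generators of `KZ.FormalRep` killing dimension `0` and
sending each family `⟨k + 1, r⟩` to the class `KZ.of r'` of some weight-slab blow-up `r'` of `r`
(`r'.domain = {z | 0 < z 1 < z 0 < 1, tail z ∈ r.domain}`,
`r'.integrand z = (z 1 / z 0 ^ 2) r.integrand (tail z)`), the additive extension
`FreeAbelianGroup.lift T` maps `KZ.fibredRelations` into itself: by `AddSubgroup.closure_le` it
suffices to treat the four kinds of fibred generators (`blowup_sub_mem_domainAddRel`,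
`blowup_sub_mem_integrandAddRel`, `blowup_sub_mem_fibredChangeOfVariablesRel`,
`blowup_sub_mem_newtonLeibnizRel`, the fibred Newton–Leibniz set unpacked by
`KZ.mem_fibredNewtonLeibnizRel_iff`; dimension-`0` additivity instances go to `0`,
`dilate_lift_of`), as in `KZ.slabMap_mem_fibredRelations` and
`stub_dilateMap_mem_fibredRelations`. [Kontsevich–Zagier 2001, §1.2 rules (1)–(3)] [folklore] -/
theorem stub_blowupMap_mem_fibredRelations : ∀ (T : (Σ k, Literature.NumberTheory.Transcendental.KZ.IntegralRep k) → Literature.NumberTheory.Transcendental.KZ.FormalRep), (∀ r : Literature.NumberTheory.Transcendental.KZ.IntegralRep 0, T ⟨0, r⟩ = 0) → (∀ (k : ℕ) (r : Literature.NumberTheory.Transcendental.KZ.IntegralRep (k + 1)), ∃ r' : Literature.NumberTheory.Transcendental.KZ.IntegralRep (k + 1 + 1), T ⟨k + 1, r⟩ = Literature.NumberTheory.Transcendental.KZ.of r' ∧ r'.domain = {z | 0 < z 1 ∧ z 1 < z 0 ∧ z 0 < 1 ∧ (fun i : Fin (k + 1) => z i.succ) ∈ r.domain} ∧ r'.integrand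 = fun z => z 1 / z 0 ^ 2 * r.integrand (fun i : Fin (k + 1) => z i.succ)) → ∀ c ∈ Literature.NumberTheory.Transcendental.KZ.fibredRelations, FreeAbelianGroup.lift T c ∈ Literature.NumberTheory.Transcendental.KZ.fibredRelations := by
  intro T hT0 hfam c hc
  refine (AddSubgroup.closure_le (fibredRelations.comap (FreeAbelianGroup.lift T))).mpr ?_ hc
  rintro c (((hc | hc) | hc) | hc)
  · obtain ⟨k, r, r₁, r₂, hdom, hnull, h₁, h₂, rfl⟩ := hc
    rw [AddSubgroup.coe_comap, mem_preimage, map_sub, map_sub, dilate_lift_of, dilate_lift_of,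
      dilate_lift_of]
    cases k with
    | zero =>
      rw [hT0, hT0, hT0, sub_zero, sub_zero]
      exact fibredRelations.zero_mem
    | succ k =>
      obtain ⟨s, hs, hsd, hsi⟩ := hfam k r
      obtain ⟨s₁, hs₁, hsd₁, hsi₁⟩ := hfam k r₁
      obtain ⟨s₂, hs₂, hsd₂, hsi₂⟩ := hfam k r₂
      rw [hs, hs₁, hs₂]
      exact mem_fibredRelations_of_mem_domainAddRel
        (blowup_sub_mem_domainAddRel hdom hnull h₁ h₂ hsd hsi hsd₁ hsi₁ hsd₂ hsi₂)
  · obtain ⟨k, r, r₁, r₂, h₁, h₂, hadd, rfl⟩ := hc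
    rw [AddSubgroup.coe_comap, mem_preimage, map_sub, map_sub, dilate_lift_of, dilate_lift_of,
      dilate_lift_of]
    cases k with
    | zero =>
      rw [hT0, hT0, hT0, sub_zero, sub_zero]
      exact fibredRelations.zero_mem
    | succ k =>
      obtain ⟨s, hs, hsd, hsi⟩ := hfam k r
      obtain ⟨s₁, hs₁, hsd₁, hsi₁⟩ := hfam k r₁
      obtain ⟨s₂, hs₂, hsd₂, hsi₂⟩ := hfam k r₂
      rw [hs, hs₁, hs₂]
      exact mem_fibredRelations_of_mem_integrandAddRel
        (blowup_sub_mem_integrandAddRel h₁ h₂ hadd hsd hsi hsd₁ hsi₁ hsd₂ hsi₂)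
  · obtain ⟨k, r, r', Φ, Φ', hΦ, hΦ', hinj, hdom, hf, h0, rfl⟩ := hc
    obtain ⟨s, hs, hsd, hsi⟩ := hfam k r
    obtain ⟨s', hs', hsd', hsi'⟩ := hfam k r'
    rw [AddSubgroup.coe_comap, mem_preimage, map_sub, dilate_lift_of, dilate_lift_of, hs, hs']
    exact mem_fibredRelations_of_mem_fibredChangeOfVariablesRel
      (blowup_sub_mem_fibredChangeOfVariablesRel hΦ hΦ' hinj hdom hf h0 hsd hsi hsd' hsi')
  · obtain ⟨k, r, r', α, β, F, hF, hα, hβ, hle, hband, hcont, hderiv, hr', rfl⟩ :=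
      mem_fibredNewtonLeibnizRel_iff.mp hc
    obtain ⟨s, hs, hsd, hsi⟩ := hfam (k + 1) r
    obtain ⟨s', hs', hsd', hsi'⟩ := hfam k r'
    have hs2 : T ⟨k + 2, r⟩ = of s := hs
    rw [AddSubgroup.coe_comap, mem_preimage, map_sub, dilate_lift_of, dilate_lift_of, hs2, hs']
    exact mem_fibredRelations_of_mem_fibredNewtonLeibnizRel (of_sub_of_mem_fibredNewtonLeibnizRel
      (blowup_sub_mem_newtonLeibnizRel hF hα hβ hle hband hcont hderiv hr' hsd hsi hsd' hsi'))

end Summit.KontsevichZagierPeriods.ValuedFieldSpecialisation
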